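import Mathlib.Algebra.BigOperators.Ring.Finset
import Mathlib.Algebra.Order.BigOperators.Group.Finset
import Mathlib.Algebra.BigOperators.Pi
import Mathlib.Algebra.Order.Group.Abs
import Mathlib.Data.Real.Basic
import Mathlib.Data.Fintype.Card
import Mathlib.Tactic.Linarith
import Mathlib.Tactic.Ring
import Mathlib.Tactic.FieldSimp
import HarnessLib

/-!
# Barrier catalogue `QuantumAdvantage` — the linear cross-entropy benchmark can be spoofed

Topic `Literature/Barriers/QuantumAdvantage` (D-0021). Summit statement:
`QuantumAdvantage := ∃ L, L ∈ BQP ∧ L ∉ BPP`.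

BARRIER: technique_class := certifying a finite random-circuit-sampling (RCS) experiment as a
  classically intractable task *through the linear cross-entropy benchmark alone*: the device's
  samples reach a linear cross-entropy fidelity `F_XEB ≈ 2 × 10⁻³` [cite: AruteEtAl2019, Suppl. Inf. §4 (XEB theory) and §8 (large-scale XEB results)]
  and "the computational hardness assumption underlying the experiment is that no efficient
  classical algorithm can achieve a similar score" [cite: BarakChouGao2021, §1]; the complexity
  frame for this assertion is Aaronson–Gunn's XQUATH ⟹ hardness of XHOG [cite: AaronsonGunn2020, §1–2 (Def. 1, Problem 1, Thm 1)];
  blocks := reading such an XEB score as evidence for the summit, or for `SampBPP ≠ SampBQP`,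
  beyond what the benchmark certifies: (i) `F_q(p)` is linear in `p`, vanishes on the uniform
  distribution and is maximised by the point mass on a mode `m` of `q`, which lies at total
  variation distance `1 − q(m)` from `q` — "a device could score well on Linear XEB while being far
  from correct in total variation distance by, for example, always outputting the items with the
  `k` highest probabilities" (`linearXEB_not_certifying`, proved below)
  [cite: AaronsonGunn2020, §1] [cite: BarakChouGao2021, §1 (footnote 1)]; (ii) for circuits of
  depth `d` with light cones of size `L` and Haar-random two-qubit gates a classical randomized
  algorithm running in time `poly(n, 2^L)` attains expected fidelity
  `E_C[F_C(A_C)] ≥ (1 + 15^{-d})^{⌊n/L⌋} − 1`, hence `ω(1)` in polynomial time for two-dimensional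
  circuits of depth `O(√log n)` [cite: BarakChouGao2021, Thm 1 and Cor 2]; (iii) a classical
  algorithm reaching "2-12% of those [XEB values] obtained in the state-of-the-art experiments,
  within just a few seconds using a single GPU", with "better scaling with the system size than a
  noisy quantum device" [cite: GaoEtAl2024, (abstract)], and, by tensor-network contraction, `10⁶`
  uncorrelated samples of fidelity `≈ 0.0037` (above the experimental `≈ 0.002`) for the 53-qubit,
  20-cycle instance in `15 h` on `512` GPUs [cite: PanChenZhang2022, (abstract)]; (iv) with a
  constant rate of depolarizing noise and anti-concentration, "no statistical tests, like the XEB,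
  HOG and log XEB, can distinguish between noisy RCS and [a polynomial-time] classical algorithm",
  and XQUATH is refuted in that setting [cite: AharonovEtAl2023, Thm 1, Cor 1, §1.2 and App. A];
  because := the benchmark rewards correlation with the heavy outputs of `q_C`, not closeness of
  distributions (item (i)); Barak–Chou–Gao sample light-cone-sized subcircuits exactly and show
  the resulting marginals keep an `15^{-d}` correlation per block [cite: BarakChouGao2021, §1 and Thm 1];
  Gao et al. "identify and exploit several vulnerabilities of the XEB", explained by mapping average
  XEB and fidelity to classical statistical-mechanics models [cite: GaoEtAl2024, (abstract)];
  evasions_known := conditional hardness of spoofing: XQUATH implies that no polynomial-time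
  classical algorithm solves XHOG with `b > 1` [cite: AaronsonGunn2020, Thm 1] (an assumption
  "called into question" for the experimental parameters [cite: AharonovEtAl2023, §1.2]); operating
  in the identified weak-noise phase where XEB tracks fidelity, at `67` qubits and `32` cycles
  [cite: MorvanEtAl2024, (abstract)]; replacing XEB by tasks with efficient verification (e.g. the
  `NP`-search separation relative to a random oracle, tree fact `yamakawa_zhandry`)
  [cite: YamakawaZhandry2022, Thm. 1.1];
  status := theorem for (i) (proved here) and (ii), (iv) (theorems in print); (iii) documented
  computations as printed.

## Contents (all with real proofs)

* `linearXEB q p` — the linear cross-entropy fidelity `F_q(p) = N · Σₓ q(x) p(x) − 1` of a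
  distribution `p` against the ideal `q` on `N` outcomes (Arute et al.; Barak–Chou–Gao §1).
* `pointMass m` (`δ_m`), `linearXEB_uniform` (`F_q(uniform) = 0`), `linearXEB_single`
  (`F_q(δ_m) = N q(m) − 1`), `depolarize F p` with `linearXEB_depolarize`
  (`F_q(F·p + (1−F)·u) = F · F_q(p)`, the benign global-depolarizing reading) and
  `abs_depolarize_sub_uniform` (`|p_F(x) − 1/N| = F |p(x) − 1/N|`),
  `linearXEB_le_linearXEB_single` (a mode maximises `F_q` over all distributions),
  `halfL1_single_eq` (`Δ(δ_m, q) = 1 − q(m)`), and the packaged `linearXEB_not_certifying`.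
* `linearXEB_mixture` (the benchmark is linear in the sampled distribution: the `μ`-average of
  `F_q(p_ω)` is `F_q` of the mixture) and `linearXEB_avg_eq_zero_of_mixture_uniform` (a randomized
  sampler whose average output is uniform — e.g. any circuit-independent, relabelling-invariant
  sampler such as a fresh flat-Dirichlet "frozen-tree" draw [Oh2026] — has expected linear XEB `0`
  against every ideal `q`: it does not spoof an XEB-scored experiment).

## Design notes

* Distributions on a finite outcome type `α` (for RCS, `α = Fin n → Bool`, `N = 2ⁿ`) are
  real-valued mass functions with explicit hypotheses `0 ≤ p`, `Σ p = 1`; this keeps the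
  statements elementary and avoids `ℝ≥0∞` coercions of `PMF` (the tree's `PMF.tvDist` is the same
  `½ Σ |p − q|`).
* Mathlib has no cross-entropy benchmark (`lean search 'crossEntropy|XEB'`: no hits).

## References

* [AruteEtAl2019] F. Arute et al., *Quantum supremacy using a programmable superconducting
  processor*, Nature 574 (2019) 505–510; Supplementary Information arXiv:1910.11333, §4 (XEB
  theory), §8. Read via `lit read paper:arxiv-1910.11333`.
* [AaronsonGunn2020] S. Aaronson, S. Gunn, *On the classical hardness of spoofing linear
  cross-entropy benchmarking*, Theory Comput. 16 (2020) art. 11 (arXiv:1910.12085): §1, Def. 1,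
  Problem 1, Thm 1. Read via `lit read paper:arxiv-1910.12085`.
* [BarakChouGao2021] B. Barak, C.-N. Chou, X. Gao, *Spoofing linear cross-entropy benchmarking in
  shallow quantum circuits*, ITCS 2021, LIPIcs 185, 30:1–30:20 (arXiv:2005.02421): §1 (fn. 1),
  Thm 1, Cor 2. Read via `lit read paper:url-8fc04fcb0627`.
* [GaoEtAl2024] X. Gao, M. Kalinowski, C.-N. Chou, M. D. Lukin, B. Barak, S. Choi, *Limitations of
  linear cross-entropy as a measure for quantum advantage*, PRX Quantum 5 (2024) 010334
  (arXiv:2112.01657), abstract.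
* [PanChenZhang2022] F. Pan, K. Chen, P. Zhang, Phys. Rev. Lett. 129 (2022) 090502
  (arXiv:2111.03011), abstract.
* [AharonovEtAl2023] D. Aharonov, X. Gao, Z. Landau, Y. Liu, U. Vazirani, *A polynomial-time
  classical algorithm for noisy random circuit sampling*, STOC 2023, 945–957 (arXiv:2211.03999):
  Thm 1, Cor 1, §1.2, App. A.
* [MorvanEtAl2024] A. Morvan et al., *Phase transitions in random circuit sampling*, Nature 634
  (2024) 328–333 (arXiv:2304.11119), abstract.
* [YamakawaZhandry2022] T. Yamakawa, M. Zhandry, FOCS 2022, Thm 1.1.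
* [Oh2026] S. Oh, *Frozen-tree sampling refutes quantum advantage of random circuit sampling*,
  arXiv:2607.04054v1 (2026), abstract and Fig. 1 (the flat-Dirichlet / Beta binary-tree sampler,
  "no statistical test acting on samples alone can distinguish"). Read via `lit read arxiv:2607.04054`.
* [HangleiterEtAl2019] D. Hangleiter, M. Kliesch, J. Eisert, C. Gogolin, *Sample complexity of
  device-independently certified "quantum supremacy"*, Phys. Rev. Lett. 122 (2019) 210502
  (arXiv:1812.01023), Thm. 7.
-/

noncomputable section

open Finset

namespace Literature.Barriers.QuantumAdvantage

variable {α : Type*}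

section PointMass

variable [DecidableEq α]

/-- The point mass (deterministic distribution) at `m`, as a real mass function. [folklore] -/
def pointMass (m : α) : α → ℝ :=
  Pi.single m 1

/-- `pointMass m m = 1`. [folklore] -/
@[simp] theorem pointMass_self (m : α) : pointMass m m = 1 := by
  simp [pointMass]

/-- `pointMass m x = 0` for `x ≠ m`. [folklore] -/
@[simp] theorem pointMass_of_ne {m x : α} (h : x ≠ m) : pointMass m x = 0 := by
  simp [pointMass, h]

/-- The point mass is nonnegative. [folklore] -/
theorem pointMass_nonneg (m x : α) : 0 ≤ pointMass m x := by
  by_cases h : x = m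
  · subst h; simp
  · simp [h]

/-- The point mass sums to `1`. [folklore] -/
theorem sum_pointMass [Fintype α] (m : α) : ∑ x, pointMass m x = 1 := by
  rw [Finset.sum_eq_single m (fun b _ hb => pointMass_of_ne hb) (fun h => absurd (Finset.mem_univ m) h)]
  simp

end PointMass

variable [Fintype α]

/-- The **linear cross-entropy benchmark fidelity** of a distribution `p` with respect to the ideal
distribution `q` on a finite outcome space with `N = |α|` points:
`F_q(p) = N · Σₓ q(x) p(x) − 1` (Barak–Chou–Gao's `𝓕_C(p) = 2ⁿ E_{x∼p} q_C(x) − 1`; the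
experimental estimator averages `2ⁿ q_C(xᵢ) − 1` over the samples `xᵢ ∼ p`).
[cite: BarakChouGao2021, §1] -/
def linearXEB (q p : α → ℝ) : ℝ :=
  (Fintype.card α : ℝ) * ∑ x, q x * p x - 1

/-- A trivial simulator scores zero: `F_q(uniform) = 0` for every distribution `q`.
[cite: BarakChouGao2021, §1 ("A trivial simulation … will achieve F_C(p) = 0")] -/
theorem linearXEB_uniform [Nonempty α] (q : α → ℝ) (hq : ∑ x, q x = 1) :
    linearXEB q (fun _ => (Fintype.card α : ℝ)⁻¹) = 0 := by
  unfold linearXEB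
  have hN : (Fintype.card α : ℝ) ≠ 0 := by exact_mod_cast Fintype.card_ne_zero
  rw [← Finset.sum_mul, hq, one_mul, mul_inv_cancel₀ hN, sub_self]

/-- The point mass at `m` scores `F_q(δ_m) = N · q(m) − 1`. [cite: BarakChouGao2021, §1 (footnote 1)] -/
theorem linearXEB_single [DecidableEq α] (q : α → ℝ) (m : α) :
    linearXEB q (pointMass m) = Fintype.card α * q m - 1 := by
  unfold linearXEB
  congr 2
  rw [Finset.sum_eq_single m (fun b _ hb => by simp [hb]) (fun h => absurd (Finset.mem_univ m) h)]
  simp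

/-- For a distribution `p`, `Σₓ q(x) p(x) ≤ max q`. [cite: BarakChouGao2021, §1 (footnote 1)] -/
theorem sum_mul_le_of_forall_le (q p : α → ℝ) (m : α) (hm : ∀ x, q x ≤ q m)
    (hp0 : ∀ x, 0 ≤ p x) (hp1 : ∑ x, p x = 1) : ∑ x, q x * p x ≤ q m :=
  calc ∑ x, q x * p x ≤ ∑ x, q m * p x :=
        Finset.sum_le_sum fun x _ => mul_le_mul_of_nonneg_right (hm x) (hp0 x)
    _ = q m * ∑ x, p x := by rw [Finset.mul_sum]
    _ = q m := by rw [hp1, mul_one]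

/-- **A mode maximises the benchmark over all distributions**: if `q(x) ≤ q(m)` for all `x`, then
`F_q(p) ≤ F_q(δ_m)` for every distribution `p` — in particular for `p = q` itself and for the
output of any device. [cite: BarakChouGao2021, §1 (footnote 1: "q_C is not the maximizer of F_C(p)")] -/
theorem linearXEB_le_linearXEB_single [DecidableEq α] (q p : α → ℝ) (m : α)
    (hm : ∀ x, q x ≤ q m) (hp0 : ∀ x, 0 ≤ p x) (hp1 : ∑ x, p x = 1) :
    linearXEB q p ≤ linearXEB q (pointMass m) := by
  rw [linearXEB_single]
  unfold linearXEB
  have hN : (0 : ℝ) ≤ Fintype.card α := Nat.cast_nonneg _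
  have h := sum_mul_le_of_forall_le q p m hm hp0 hp1
  exact sub_le_sub_right (mul_le_mul_of_nonneg_left h hN) 1

/-- A probability mass function is pointwise at most `1`. [folklore] -/
theorem apply_le_one_of_sum_eq_one (q : α → ℝ) (hq0 : ∀ x, 0 ≤ q x) (hq1 : ∑ x, q x = 1)
    (m : α) : q m ≤ 1 :=
  hq1 ▸ Finset.single_le_sum (fun i _ => hq0 i) (Finset.mem_univ m)

/-- The total variation distance `½ Σₓ |δ_m(x) − q(x)|` between the point mass at `m` and `q` is
`1 − q(m)`. [cite: AaronsonGunn2020, §1 ("far from correct in total variation distance")] -/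
theorem halfL1_single_eq [DecidableEq α] (q : α → ℝ) (hq0 : ∀ x, 0 ≤ q x) (hq1 : ∑ x, q x = 1)
    (m : α) : (1 / 2 : ℝ) * ∑ x, |pointMass m x - q x| = 1 - q m := by
  have hqm1 : q m ≤ 1 := apply_le_one_of_sum_eq_one q hq0 hq1 m
  have hsplit : ∑ x, |pointMass m x - q x| =
      |1 - q m| + ∑ x ∈ Finset.univ.erase m, |0 - q x| := by
    rw [← Finset.add_sum_erase _ _ (Finset.mem_univ m)]
    congr 1
    · simp
    · refine Finset.sum_congr rfl fun x hx => ?_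
      rw [pointMass_of_ne (Finset.ne_of_mem_erase hx)]
  have hrest : ∑ x ∈ Finset.univ.erase m, |0 - q x| = 1 - q m := by
    have hsum : ∑ x ∈ Finset.univ.erase m, q x = 1 - q m := by
      rw [← hq1, ← Finset.add_sum_erase _ _ (Finset.mem_univ m)]
      ring
    rw [← hsum]
    refine Finset.sum_congr rfl fun x _ => ?_
    rw [zero_sub, abs_neg, abs_of_nonneg (hq0 x)]
  rw [hsplit, hrest, abs_of_nonneg (by linarith)]
  ring

/-- The **global depolarizing model** of a noisy device with fidelity `F`: the output is the
convex combination `F · p + (1 − F) · uniform` ("the output probabilities are a convex combination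
of the true distribution with the uniform distribution", the simplified noise model under which
Arute et al. argue). [cite: BoulandFeffermanLandauLiu2022, §1 (footnote on global depolarizing noise)] -/
def depolarize (F : ℝ) (p : α → ℝ) : α → ℝ :=
  fun x => F * p x + (1 - F) * (Fintype.card α : ℝ)⁻¹

/-- **In the global depolarizing model the benchmark reads off the fidelity**:
`F_q(F · p + (1 − F) · u) = F · F_q(p)` for every ideal `q` (a distribution) and every `p`; with
`p = q_C` Porter–Thomas (`F_q(q) ≈ 1` in the `2ⁿ Σ q² − 1` normalisation) this is the "benign
setting" in which XEB estimates fidelity. Real proof. [cite: GaoEtAl2024, (abstract, "benign setting")] -/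
theorem linearXEB_depolarize [Nonempty α] (q p : α → ℝ) (hq : ∑ x, q x = 1) (F : ℝ) :
    linearXEB q (depolarize F p) = F * linearXEB q p := by
  unfold linearXEB depolarize
  have hN : (Fintype.card α : ℝ) ≠ 0 := by exact_mod_cast Fintype.card_ne_zero
  have hsum : ∑ x, q x * (F * p x + (1 - F) * (Fintype.card α : ℝ)⁻¹) =
      F * ∑ x, q x * p x + (1 - F) * (Fintype.card α : ℝ)⁻¹ := by
    simp only [mul_add, Finset.sum_add_distrib]
    congr 1
    · rw [Finset.mul_sum]
      exact Finset.sum_congr rfl fun x _ => by ring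
    · rw [← Finset.sum_mul, hq]
      ring
  rw [hsum]
  field_simp
  ring

/-- In the global depolarizing model the deviation of every output probability from `1/N` is
exactly `F` times the ideal deviation: `|p_F(x) − 1/N| = F · |p(x) − 1/N|` (`F ≥ 0`). Hence the
constant estimator `1/N` already approximates the noisy probabilities to additive error
`F · maxₓ |p(x) − 1/N|`, the elementary fact behind "it cannot possibly be hard to compute the output
probabilities of high-noise circuits to additive imprecision `2^{-o(m)}`" when `F = 2^{-Θ(m)}`.
Real proof. [cite: BoulandFeffermanLandauLiu2022, §1 (convergence to uniformity and optimality of Thm 2)] -/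
theorem abs_depolarize_sub_uniform (F : ℝ) (hF : 0 ≤ F) (p : α → ℝ) (x : α) :
    |depolarize F p x - (Fintype.card α : ℝ)⁻¹| = F * |p x - (Fintype.card α : ℝ)⁻¹| := by
  unfold depolarize
  rw [← abs_of_nonneg hF, ← abs_mul, abs_of_nonneg hF]
  congr 1
  ring

/-- **The benchmark is linear in the sampled distribution**: for weights `μ` on a finite index type
`Ω` with `Σ_ω μ(ω) = 1` (the internal randomness of a randomized sampler) and any family of output
distributions `p_ω`, the `μ`-average of `F_q(p_ω)` equals `F_q` of the mixture
`x ↦ Σ_ω μ(ω) p_ω(x)` — "`𝓕_C(p)` is linear in `p`". Real proof. [cite: BarakChouGao2021, §1] -/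
theorem linearXEB_mixture {Ω : Type*} [Fintype Ω] (q : α → ℝ) (μ : Ω → ℝ) (hμ : ∑ ω, μ ω = 1)
    (p : Ω → α → ℝ) :
    ∑ ω, μ ω * linearXEB q (p ω) = linearXEB q (fun x => ∑ ω, μ ω * p ω x) := by
  unfold linearXEB
  have key : ∑ ω, μ ω * ((Fintype.card α : ℝ) * ∑ x, q x * p ω x)
      = (Fintype.card α : ℝ) * ∑ x, q x * ∑ ω, μ ω * p ω x := by
    simp only [Finset.mul_sum]
    rw [Finset.sum_comm]
    exact Finset.sum_congr rfl fun x _ => Finset.sum_congr rfl fun ω _ => by ring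
  simp only [mul_sub, mul_one, Finset.sum_sub_distrib, hμ, key]

/-- **A circuit-independent sampler has mean linear XEB exactly zero.** If a randomized classical
sampler outputs, on internal randomness `ω` (weights `μ`, `Σ μ = 1`), a distribution `p_ω` chosen
without reference to the ideal distribution `q`, and its average output is uniform —
`Σ_ω μ(ω) p_ω(x) = 1/N` for every outcome `x`, which holds for every sampler whose law is invariant
under relabelling the `N` outcomes, e.g. a fresh flat-Dirichlet ("frozen-tree") draw
`p_ω ∼ Dir(1, …, 1)` proposed as a classical stand-in for random circuit sampling
[cite: Oh2026, (abstract and Fig. 1)] — then its `μ`-expected benchmark value against ANY ideal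
distribution `q` is `0`, the score of the trivial uniform sampler (`linearXEB_uniform`). Such a
sampler therefore attains no positive expected linear XEB against a fixed circuit; what it
witnesses is the distinct, known fact that sampling from flat distributions cannot be certified from
the samples alone, without the ideal probabilities [cite: HangleiterEtAl2019, Thm. 7 (random universal circuits: no ε-certification test from fewer than Ω(2^{n/4}δ^{1/4}/ε²) samples)]. Real proof.
[cite: BarakChouGao2021, §1 ("A trivial simulation … will achieve F_C(p) = 0")] -/
theorem linearXEB_avg_eq_zero_of_mixture_uniform [Nonempty α] {Ω : Type*} [Fintype Ω]
    (q : α → ℝ) (hq : ∑ x, q x = 1) (μ : Ω → ℝ) (hμ : ∑ ω, μ ω = 1) (p : Ω → α → ℝ)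
    (hunif : ∀ x, ∑ ω, μ ω * p ω x = (Fintype.card α : ℝ)⁻¹) :
    ∑ ω, μ ω * linearXEB q (p ω) = 0 := by
  rw [linearXEB_mixture q μ hμ p, show (fun x => ∑ ω, μ ω * p ω x) =
    fun _ => (Fintype.card α : ℝ)⁻¹ from funext hunif]
  exact linearXEB_uniform q hq

/-- **The linear XEB does not certify closeness to the ideal distribution** (Aaronson–Gunn §1;
Barak–Chou–Gao §1 fn. 1). For every distribution `q` on a finite outcome space and every mode `m`
of `q`: the deterministic "always output `m`" distribution scores at least as high on the linear
cross-entropy benchmark as every distribution whatsoever, and its total variation distance to `q`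
is `1 − q(m)` (close to `1` whenever `q` is anti-concentrated, e.g. `q(m) = O(n · 2⁻ⁿ)` for
Porter–Thomas statistics on `n` qubits). Real proof.
[cite: AaronsonGunn2020, §1] [cite: BarakChouGao2021, §1 (footnote 1)] -/
theorem linearXEB_not_certifying [DecidableEq α] (q : α → ℝ) (hq0 : ∀ x, 0 ≤ q x)
    (hq1 : ∑ x, q x = 1) (m : α) (hm : ∀ x, q x ≤ q m) :
    (∀ p : α → ℝ, (∀ x, 0 ≤ p x) → ∑ x, p x = 1 → linearXEB q p ≤ linearXEB q (pointMass m)) ∧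
      (1 / 2 : ℝ) * ∑ x, |pointMass m x - q x| = 1 - q m :=
  ⟨fun p hp0 hp1 => linearXEB_le_linearXEB_single q p m hm hp0 hp1, halfL1_single_eq q hq0 hq1 m⟩

end Literature.Barriers.QuantumAdvantage

end
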